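import Literature.IUT.HodgeTheaters.PiAvatarLocalArrowLawL1OfTorsionMonodromy
import Literature.IUT.HodgeTheaters.PiAvatarLocalArrowLawL2Sign
import HarnessLib

/-!
# [IUTchI] Def 6.1 (ii)(iii) / Ex 6.3 (i): the LOCAL ARROW LAW of every local group `Π_v̲` CONSTRUCTED — abc-iut-L5-t4's
# binder `Λ : D.LocalArrowLaw CG hS (Π_{X̲→_K} ∩ augGF⁻¹ G_v̲)` from `{TorsionMonodromy, ArrowCoveringClaims, hI}`
# (proof-only assembly of the (L1) and (L2) files; post-freeze additive D13 piece, not a cone member)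

S. Mochizuki, *Inter-universal Teichmüller theory I*, kurims manuscript (May 2020), §6 Def 6.1 (ii)(iii) pp. 156–157, Ex 6.3
(i) p. 161 [cite: Mochizuki2012, Def 6.1(ii)(iii) pp.156-157; Ex 6.3(i) p.161] (D-0012 claim key; series DISPUTED — nothing of
the series is asserted; no side is taken on [IUTchIII] Cor. 3.12).

WHAT (abc-iut-L5-lead gen 6 RULINGS #60 (1), #62 (2)(b), #63 (2); GAP-LEDGER G-L5t4g4-1).  abc-iut-L5-t4's interface law
`InitialThetaData.LocalArrowLaw CG hS H` (p440701) — the hypothesis binder `Λ` of `LocalDatum.ofGood` / `PiAvatarLocalOvergroupUnd`,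
recorded as «NOT derivable from the typed §1/§3 data alone» — is here CONSTRUCTED at every local group
`H = Π_v̲ := Π_{X̲→_K} ∩ augGF⁻¹(G_v̲)` (every subgroup `G_v̲ ≤ G_F`) from three named inputs:
`M : D.TorsionMonodromy` (abc-iut-L5-t8's datum, NV #45), `hA : D.geom.pe.ArrowCoveringClaims` (printed §1 claims; standing
cert binder) and `hI : ∀ k ∈ I_{ε′}, M.tau (embK k) = 0` («(rel)-type classical law: the cusp inertia of `X` dies in
`Δ_X^{ab} ⊗ 𝔽_l = E[l]`», GAP G-L5d5g6-1):
* `le_PiXund` — `Π_v̲ ≤ Π_{X̲→_K} ≤ Π_{X̲_K}` (abc-iut-L5-t4 lineage `PiXarrow_le_PiXund`);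
* (L1) `mem_normalizer_of_conj_le` — `InitialThetaData.TorsionMonodromy.localArrowLaw_L1_local` (Borel argument,
  `PiAvatarLocalArrowLawL1OfTorsionMonodromy`, p445209);
* (L2) `sign` — `InitialThetaData.localArrowLaw_L2_sign_local` (ramification of `X̲→ → X̲`, `PiAvatarLocalArrowLawL2Sign`; from
  `hA` alone).
EFFECT (RULINGS #62 flip trigger (b)): at the good places the binder `Λ` of the genuine base kit `baseKitOfData … δ` is DISCHARGED
modulo `{Nonempty TorsionMonodromy, hA, hI}` — GAP G-L5t4g4-1 reads «(L1)(L2) DERIVED»; no NV witness of `LocalArrowLaw` is needed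
any more at good places (an NV witness of `hI` at abc-iut-L5-t8's semidirect model remains the t8 WAKE row).  Proof-only (0
definitions: the structure VALUE is produced by a `theorem`, `LocalArrowLaw` being a `Prop`); axioms standard.  HONEST FRAMING:
`M` is an interface datum, `hA`/`hI` assumption labels, `CG`/`hS` interface data; typed ≠ inhabited ≠ discharged; nothing here
bears on [IUTchIII] Cor. 3.12.
-/

noncomputable section

namespace Literature.IUT.HodgeTheaters

open scoped Pointwise

universe u v w

variable {F : Type u} {K : Type v} {Fbar : Type w} [Field F] [NumberField F] [Field K] [NumberField K]
  [Algebra F K] [Field Fbar] [Algebra F Fbar] [Algebra K Fbar]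
  {E : WeierstrassCurve F} [E.IsElliptic] {l : ℕ} {Pb : BadPlacePredicates K}

namespace InitialThetaData

variable {D : InitialThetaData F K Fbar E l Pb} (CG : D.geom.pe.CuspGalois) (hS : D.CuspClassesNormaliserStable)
variable [Fact l.Prime]

/-- **The LOCAL ARROW LAW of the local group `Π_v̲ = Π_{X̲→_K} ∩ augGF⁻¹(G_v̲)`, CONSTRUCTED** ([IUTchI] Def 6.1 (ii)(iii), Ex 6.3 (i)):
abc-iut-L5-t4's binder `Λ : D.LocalArrowLaw CG hS (D.PiXarrow ⊓ Gv.comap D.augGF)` for EVERY subgroup `G_v̲ ≤ G_F`, from the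
torsion-monodromy datum `M`, the printed §1 claims `hA` and the named (rel)-type law `hI` — fields: `le_PiXund` (`Π_{X̲→_K} ≤ Π_{X̲_K}`),
(L1) `localArrowLaw_L1_local` (p445209), (L2) `localArrowLaw_L2_sign_local`. ([IUTchI] Def 6.1(iii) p.157) [claim: Mochizuki2012, status: disputed] -/
theorem localArrowLaw_local_of_torsionMonodromy (M : D.TorsionMonodromy) (hA : D.geom.pe.ArrowCoveringClaims)
    (hI : ∀ k ∈ D.geom.pe.inertia D.geom.pe.ε1, M.tau (D.geom.embK k) = 0) (Gv : Subgroup (Fbar ≃ₐ[F] Fbar)) :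
    D.LocalArrowLaw CG hS (D.PiXarrow ⊓ Gv.comap D.augGF) where
  le_PiXund := le_trans inf_le_left D.PiXarrow_le_PiXund
  mem_normalizer_of_conj_le := M.localArrowLaw_L1_local hA hI Gv
  sign := D.localArrowLaw_L2_sign_local CG hS hA Gv

/-- **Non-vacuity of the binder type at the good places, relative form**: `LocalArrowLaw` at `Π_v̲` is INHABITED as soon as the
torsion-monodromy datum is (abc-iut-L5-t8's `exists_torsionMonodromy`-type witnesses, NV #45) together with `hA` and `hI`.
([IUTchI] Def 6.1(iii) p.157) [claim: Mochizuki2012, status: disputed] -/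
theorem nonempty_localArrowLaw_local (hM : ∃ M : D.TorsionMonodromy, ∀ k ∈ D.geom.pe.inertia D.geom.pe.ε1, M.tau (D.geom.embK k) = 0)
    (hA : D.geom.pe.ArrowCoveringClaims) (Gv : Subgroup (Fbar ≃ₐ[F] Fbar)) :
    D.LocalArrowLaw CG hS (D.PiXarrow ⊓ Gv.comap D.augGF) := by
  obtain ⟨M, hI⟩ := hM
  exact localArrowLaw_local_of_torsionMonodromy CG hS M hA hI Gv

end InitialThetaData

end Literature.IUT.HodgeTheaters

end
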